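/-
Origin: expansion seat `planner-pub-hodgecm-pv11-g2-0`, handover 2026-08-18 (`HOME/pub-hodgecm-pv11-g2/lean/Pv11g2/SupplyCoset.lean`, md5 6f562008, 169 lines);
landed by the gen-6 packager in gate run 22 as `HodgeCM/PerL34/SupplyCoset.lean` (import ^import Pv[0-9]+g[0-9]+\.→import HodgeCM.PerL34. ×2; stripped 3 #print/#check/#eval lines).
-/
import Summits.HodgeConjecture.HodgeCM.PerL34.SupplyArchimedean
import Summits.HodgeConjecture.HodgeCM.PerL34.RationalCoset

/-!
# Route (E) with the dictionary sentence (D4) pushed back to the definition of the theta kernel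

Unit `pub-hodgecm-pv11-g2` (DAG node #11, gen 2).  Proposed final place:
`HodgeCM/PerL34/SupplyCoset.lean`; import rewrites on landing:
`Pv11g2.SupplyArchimedean → HodgeCM.PerL34.SupplyArchimedean`,
`Pv11g2.RationalCoset → HodgeCM.PerL34.RationalCoset`.

`SupplyElementary.supply₁/₂_of_lattice` (gen 1) and `SupplyArchimedean.supply₁/₂_of_schwartz` (gen 2)
take the DICTIONARY hypothesis

  `hval : ∀ N, θ_{φ_N}(g₀,u₀) = Σ_{v ∈ Λ} F (N • v)`      (D4, `F v = φ_∞(x₀ + v)`).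

Here it is replaced by the sentence one step closer to the model,

  `hker : ∀ N ≥ 1, θ_{φ_N}(g₀,u₀) = Σ_{ξ ∈ V(K)} 1[ξ_f ∈ x₀ + N • L̂] · Φ(ξ)`,

i.e. "the theta kernel at the base point is the sum of `φ_N = φ_∞ ⊗ 1_{x₀ + N𝔏}` over the rational
points" (the DEFINITION of the theta series in the Schrödinger model, for a pure tensor), and the passage
`hker ⇒ hval` is KERNEL: `RationalCoset.tsum_indicator_thinCosetK` ((A) `V(K) ∩ (x₀ + N L̂) = x₀ + N L`,
(B) re-indexing).  The size function on `L = V(K) ∩ L̂` comes from `LatticeTheta.exists_latticeSize`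
(`L` finite free), the limit `Σ_{v ∈ L} Φ(x₀ + N v) → Φ(x₀)` from gen-1 `tendsto_tsum_nsmul`, and — in
`supply₁_of_coset_schwartz` — the absolute summability from `LatticeTheta.summable_norm_translate` for
`Φ = f ∘ ι_∞`, `f` Schwartz on `V_∞ = E`, `ι_∞(L)` inside a discrete lattice of `E`.

Remaining hypotheses of route (E) after this file, exhaustively: `CharSeparating [U(W_j)]` (PRINT, E–W
Thm 12.84; kernel by `pub-hodgecm-pv06-g2`), `hker` (D4 at the level of the definition of `θ`), `hcont` /
`heq` (D5), finiteness of the global lattice `V(K) ∩ L̂` (SETUP), and one level up the named residual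
`SupplyBridge.form_of_lift`.

No statement of the 2001 programme, of PerL or of QW8 is used or cited.
-/

set_option autoImplicit false

noncomputable section

open MeasureTheory Filter Topology
open scoped SchwartzMap
open HodgeCM.PerL34.Seesaw HodgeCM.PerL34.SupplyElementary HodgeCM.PerL34.LatticeTheta
  HodgeCM.PerL34.RationalCoset

namespace HodgeCM
namespace PerL34
namespace SupplyCoset

variable (DS : ThetaSeesawData)

variable {VK Vf : Type*} [AddCommGroup VK] [Module ℚ VK] [AddCommGroup Vf] [Module ℚ Vf]

/-- ARCHIMEDEAN DISCHARGE of the summability over the global lattice: if `ι_∞` maps `L = V(K) ∩ L̂`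
injectively into a discrete lattice `LE` of the real vector space `E` and `f` is Schwartz on `E`, then
`v ↦ ‖f (ι_∞ (x₀ + v))‖` is summable over `L`. -/
theorem summable_norm_schwartz_comp (ιf : VK →ₗ[ℚ] Vf) (Lhat : Submodule ℤ Vf)
    {E : Type*} [NormedAddCommGroup E] [NormedSpace ℝ E] [FiniteDimensional ℝ E]
    (LE : Submodule ℤ E) [DiscreteTopology LE] (ι : VK →+ E)
    (hL : ∀ v ∈ globalLattice ιf Lhat, ι v ∈ LE) (hinj : Set.InjOn ι (globalLattice ιf Lhat))
    {F : Type*} [NormedAddCommGroup F] [NormedSpace ℝ F] (f : 𝓢(E, F)) (x₀ : VK) :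
    Summable fun v : globalLattice ιf Lhat => ‖f (ι (x₀ + (v : VK)))‖ := by
  let j : globalLattice ιf Lhat → LE := fun v => ⟨ι v, hL v v.2⟩
  have hj : Function.Injective j := by
    intro v w h
    exact Subtype.ext (hinj v.2 w.2 (congrArg Subtype.val h))
  have h := (summable_norm_translate LE f (ι x₀)).comp_injective hj
  refine h.congr fun v => ?_
  simp [j, Function.comp, map_add]

/-- **SUPPLY(t¹) from the definition of the theta kernel on pure tensors `φ_∞ ⊗ 1_{x₀ + N𝔏}`.**
Hypotheses: the shell and its compact group `[U(W₁)]` with character separation (PRINT) and Haar-type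
measure; the archimedean torus `i : B →* [U(W₁)]` with weight `w`; the rational carriers
`ιf : V(K) → V(𝔸_f)`, `L̂`, with `L = V(K) ∩ L̂` finite free; `Φ = φ_∞|_{V(K)}` with `Φ(x₀) ≠ 0` and
`Σ_{v ∈ L} |Φ(x₀ + v)| < ∞`; the family `φ_N` with (D4-def) `hker`, (D5) `hcont`, `heq`.
Conclusion: for some `N ≥ 1` and some continuous unitary character `χ` of `[U(W₁)]` of the type forced by
`w`, the theta lift `θ(φ_N, χ)(g₀) ≠ 0`. -/
theorem supply₁_of_coset [CommGroup DS.A₁] [TopologicalSpace DS.A₁] [IsTopologicalGroup DS.A₁]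
    [CompactSpace DS.A₁] [MeasurableSpace DS.A₁] [BorelSpace DS.A₁] (ν₁ : Measure DS.A₁)
    [IsFiniteMeasure ν₁] [ν₁.IsOpenPosMeasure] [ν₁.IsMulRightInvariant] (hsep : CharSeparating DS.A₁)
    {B : Type*} [Monoid B] (i : B →* DS.A₁) (w : B → ℂ)
    (ιf : VK →ₗ[ℚ] Vf) (Lhat : Submodule ℤ Vf)
    [Module.Free ℤ (globalLattice ιf Lhat)] [Module.Finite ℤ (globalLattice ιf Lhat)]
    (Φ : VK → ℂ) (x₀ : VK) (hΦ0 : Φ x₀ ≠ 0)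
    (hΦ : Summable fun v : globalLattice ιf Lhat => ‖Φ (x₀ + (v : VK))‖)
    (φN : ℕ → DS.S₁) (g₀ : DS.G) (u₀ : DS.A₁)
    (hker : ∀ N : ℕ, N ≠ 0 →
      DS.thetaKernel₁ (φN N) g₀ u₀ = ∑' ξ : VK, (thinCosetK ιf Lhat x₀ N).indicator Φ ξ)
    (hcont : ∀ N : ℕ, Continuous fun u => DS.thetaKernel₁ (φN N) g₀ u)
    (heq : ∀ (N : ℕ) (u : DS.A₁) (t : B),
      DS.thetaKernel₁ (φN N) g₀ (u * i t) = w t * DS.thetaKernel₁ (φN N) g₀ u) :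
    ∃ (N : ℕ) (χ : PontryaginDual DS.A₁), 0 < N ∧
      DS.thetaLift₁ ν₁ (fun u => ((χ u : Circle) : ℂ)) (φN N) g₀ ≠ 0 ∧
        ∀ t : B, ((χ (i t) : Circle) : ℂ) * w t = 1 := by
  obtain ⟨ℓ, hℓ0, hℓ⟩ := exists_latticeSize (globalLattice ιf Lhat)
  have hlim := tendsto_tsum_nsmul ℓ hℓ0 hℓ (fun v : globalLattice ιf Lhat => Φ (x₀ + (v : VK))) hΦ
  have h0 : Φ (x₀ + ((0 : globalLattice ιf Lhat) : VK)) ≠ 0 := by simpa using hΦ0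
  obtain ⟨N, hNpos, hN⟩ := ((eventually_gt_atTop 0).and (hlim.eventually_ne h0)).exists
  have hne : ∃ u, DS.thetaKernel₁ (φN N) g₀ u ≠ 0 := ⟨u₀, by
    rw [hker N hNpos.ne', tsum_indicator_thinCosetK' ιf Lhat hNpos.ne' x₀ Φ]
    exact hN⟩
  obtain ⟨χ, h1, h2⟩ := supply_thetaLift₁ DS ν₁ hsep i w (φN N) g₀ (hcont N) hne (heq N)
  exact ⟨N, χ, hNpos, h1, h2⟩

/-- **SUPPLY(t²)**: the same over `W₂`. -/
theorem supply₂_of_coset [CommGroup DS.A₂] [TopologicalSpace DS.A₂] [IsTopologicalGroup DS.A₂]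
    [CompactSpace DS.A₂] [MeasurableSpace DS.A₂] [BorelSpace DS.A₂] (ν₂ : Measure DS.A₂)
    [IsFiniteMeasure ν₂] [ν₂.IsOpenPosMeasure] [ν₂.IsMulRightInvariant] (hsep : CharSeparating DS.A₂)
    {B : Type*} [Monoid B] (i : B →* DS.A₂) (w : B → ℂ)
    (ιf : VK →ₗ[ℚ] Vf) (Lhat : Submodule ℤ Vf)
    [Module.Free ℤ (globalLattice ιf Lhat)] [Module.Finite ℤ (globalLattice ιf Lhat)]
    (Φ : VK → ℂ) (x₀ : VK) (hΦ0 : Φ x₀ ≠ 0)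
    (hΦ : Summable fun v : globalLattice ιf Lhat => ‖Φ (x₀ + (v : VK))‖)
    (φN : ℕ → DS.S₂) (g₀ : DS.G) (u₀ : DS.A₂)
    (hker : ∀ N : ℕ, N ≠ 0 →
      DS.thetaKernel₂ (φN N) g₀ u₀ = ∑' ξ : VK, (thinCosetK ιf Lhat x₀ N).indicator Φ ξ)
    (hcont : ∀ N : ℕ, Continuous fun u => DS.thetaKernel₂ (φN N) g₀ u)
    (heq : ∀ (N : ℕ) (u : DS.A₂) (t : B),
      DS.thetaKernel₂ (φN N) g₀ (u * i t) = w t * DS.thetaKernel₂ (φN N) g₀ u) :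
    ∃ (N : ℕ) (χ : PontryaginDual DS.A₂), 0 < N ∧
      DS.thetaLift₂ ν₂ (fun u => ((χ u : Circle) : ℂ)) (φN N) g₀ ≠ 0 ∧
        ∀ t : B, ((χ (i t) : Circle) : ℂ) * w t = 1 := by
  obtain ⟨ℓ, hℓ0, hℓ⟩ := exists_latticeSize (globalLattice ιf Lhat)
  have hlim := tendsto_tsum_nsmul ℓ hℓ0 hℓ (fun v : globalLattice ιf Lhat => Φ (x₀ + (v : VK))) hΦ
  have h0 : Φ (x₀ + ((0 : globalLattice ιf Lhat) : VK)) ≠ 0 := by simpa using hΦ0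
  obtain ⟨N, hNpos, hN⟩ := ((eventually_gt_atTop 0).and (hlim.eventually_ne h0)).exists
  have hne : ∃ u, DS.thetaKernel₂ (φN N) g₀ u ≠ 0 := ⟨u₀, by
    rw [hker N hNpos.ne', tsum_indicator_thinCosetK' ιf Lhat hNpos.ne' x₀ Φ]
    exact hN⟩
  obtain ⟨χ, h1, h2⟩ := supply_thetaLift₂ DS ν₂ hsep i w (φN N) g₀ (hcont N) hne (heq N)
  exact ⟨N, χ, hNpos, h1, h2⟩

/-- **SUPPLY(t¹), fully archimedean form.**  `Φ := f ∘ ι_∞` for a Schwartz function `f = φ_∞` on the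
real vector space `E = V_∞`, the diagonal map `ι_∞ : V(K) → V_∞` carrying `L = V(K) ∩ L̂` injectively
into a discrete lattice `LE ≤ E`, and `f (ι_∞ x₀) ≠ 0`: then the summability hypothesis of
`supply₁_of_coset` HOLDS (`summable_norm_schwartz_comp`), and the supply conclusion follows from
`CharSeparating`, `hker`, `hcont`, `heq` alone. -/
theorem supply₁_of_coset_schwartz [CommGroup DS.A₁] [TopologicalSpace DS.A₁]
    [IsTopologicalGroup DS.A₁] [CompactSpace DS.A₁] [MeasurableSpace DS.A₁] [BorelSpace DS.A₁]
    (ν₁ : Measure DS.A₁) [IsFiniteMeasure ν₁] [ν₁.IsOpenPosMeasure] [ν₁.IsMulRightInvariant]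
    (hsep : CharSeparating DS.A₁) {B : Type*} [Monoid B] (i : B →* DS.A₁) (w : B → ℂ)
    (ιf : VK →ₗ[ℚ] Vf) (Lhat : Submodule ℤ Vf)
    [Module.Free ℤ (globalLattice ιf Lhat)] [Module.Finite ℤ (globalLattice ιf Lhat)]
    {E : Type*} [NormedAddCommGroup E] [NormedSpace ℝ E] [FiniteDimensional ℝ E]
    (LE : Submodule ℤ E) [DiscreteTopology LE] (ι : VK →+ E)
    (hL : ∀ v ∈ globalLattice ιf Lhat, ι v ∈ LE) (hinj : Set.InjOn ι (globalLattice ιf Lhat))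
    (f : 𝓢(E, ℂ)) (x₀ : VK) (hx₀ : f (ι x₀) ≠ 0)
    (φN : ℕ → DS.S₁) (g₀ : DS.G) (u₀ : DS.A₁)
    (hker : ∀ N : ℕ, N ≠ 0 →
      DS.thetaKernel₁ (φN N) g₀ u₀ =
        ∑' ξ : VK, (thinCosetK ιf Lhat x₀ N).indicator (fun ξ => f (ι ξ)) ξ)
    (hcont : ∀ N : ℕ, Continuous fun u => DS.thetaKernel₁ (φN N) g₀ u)
    (heq : ∀ (N : ℕ) (u : DS.A₁) (t : B),
      DS.thetaKernel₁ (φN N) g₀ (u * i t) = w t * DS.thetaKernel₁ (φN N) g₀ u) :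
    ∃ (N : ℕ) (χ : PontryaginDual DS.A₁), 0 < N ∧
      DS.thetaLift₁ ν₁ (fun u => ((χ u : Circle) : ℂ)) (φN N) g₀ ≠ 0 ∧
        ∀ t : B, ((χ (i t) : Circle) : ℂ) * w t = 1 :=
  supply₁_of_coset DS ν₁ hsep i w ιf Lhat (fun ξ => f (ι ξ)) x₀ hx₀
    (summable_norm_schwartz_comp ιf Lhat LE ι hL hinj f x₀) φN g₀ u₀ hker hcont heq

end SupplyCoset
end PerL34
end HodgeCM

end

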